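import Summits.PneNP.PneNP.Theorems.SzkEntropyPeaThreeNotInP
import Mathlib.Analysis.SpecialFunctions.Log.Base

/-!
# Route SzkEntropy, crux `PeaThreeNotInP` (stmt-PneNP-10776), line `Sketch` (card `two-to-one-rigidity`):
# the rigid sub-promise INJ-vs-2TO1₃ and its transfer to X

The second checked line of the crux (skeleton `Cruxes/PeaThreeNotInP/SketchIdeator1.lean`, card
`Ideas/two-to-one-rigidity.md`), landed for the record by the line lead: replace the averaged quantity of
the crux (Shannon entropy within one bit) by its RIGID extreme — the promise problem INJ-vs-2TO1₃, "is this
cubic map `p : F₂ⁿ → F₂^m` injective (every fibre a point, `H = n`) or exactly two-to-one (every fibre a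
pair, `H = n - 1`)?", literally the sub-promise of `PEA 3` at threshold `k = n - 1`.  Hence
`peaThreeNotInP_of_injTwoToOne : InjTwoToOne ∉ PromiseP → PeaThreeNotInP` (sub-promise monotonicity of
`promiseLift`).  The hypothesis is an open conjecture (stronger than X; in `pr-coNP ∩ prSZK`), not claimed.

* `ConstFibre P c` — every fibre of the sparse map has exactly `c` points; `entropy_eq_of_constFibre`:
  then `H(P(U_n)) = n - log₂ c`;
* `InjTwoToOne` — the promise problem (same encoding as `PEA`); `injTwoToOne_yes_subset`,
  `injTwoToOne_no_subset`; `peaThreeNotInP_of_injTwoToOne`.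

Sources: the card `Cruxes/PeaThreeNotInP/Ideas/two-to-one-rigidity.md`; Z. Dvir, D. Gutfreund,
G. N. Rothblum, S. Vadhan, ICS 2011, §4.4 (rigid `PED^{MIN,MAX,+1}` variants), Claim 2.2 (flat sources).
-/

noncomputable section

open Finset
open _root_.Computability
open Literature.InformationTheory.Entropy
open Literature.Computability.Complexity

namespace Summit.PneNP.PneNP.Cruxes.PeaThreeNotInP.TwoToOneLine

set_option linter.dupNamespace false -- `Summit.PneNP.PneNP.…`: summit = sub-problem name (D-0017 single-conjunct layout)

/-- Every fibre of the sparse map `P : F₂ⁿ → F₂^m` (over all of `F₂ⁿ`) has exactly `c` points.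
[card two-to-one-rigidity] -/
def ConstFibre {n : ℕ} (P : PolyMapF2 n) (c : ℕ) : Prop :=
  ∀ x : Fin n → ZMod 2, (univ.filter fun x' : Fin n → ZMod 2 => P.eval x' = P.eval x).card = c

/-- **INJ-vs-2TO1₃**: on instances `(n, p, k)` of `PEA` with `k + 1 = n` and `deg p ≤ 3`, YES iff `p` is
injective on `F₂ⁿ` (all fibres singletons), NO iff `p` is exactly two-to-one; a sub-promise problem of
`PEA 3` (`injTwoToOne_yes_subset`, `injTwoToOne_no_subset`). [card two-to-one-rigidity] -/
def InjTwoToOne : PromiseProblem :=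
  PromiseProblem.ofEncoding PEAInst.encoding
    {I | PolyMapF2.DegLE 3 I.2.1 ∧ I.2.2 + 1 = I.1 ∧ ConstFibre I.2.1 1}
    {I | PolyMapF2.DegLE 3 I.2.1 ∧ I.2.2 + 1 = I.1 ∧ ConstFibre I.2.1 2}

/-- A map on `F₂ⁿ` all of whose fibres have `c` points has output entropy `n - log₂ c` (flat on its
image). [DvirGutfreundRothblumVadhan2010, Claim 2.2] -/
theorem entropy_eq_of_constFibre {n c : ℕ} (P : PolyMapF2 n) (hc : 0 < c) (h : ConstFibre P c) :
    P.entropy = n - Real.logb 2 c := by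
  unfold PolyMapF2.entropy Literature.InformationTheory.Entropy.mapEntropy
  have hcard : ((univ : Finset (Fin n → ZMod 2)).card : ℝ) = (2 : ℝ) ^ n := by simp
  have hfib : ∀ x : Fin n → ZMod 2,
      ((Literature.InformationTheory.Entropy.fiber univ P.eval (P.eval x)).card : ℝ) = c := by
    intro x
    unfold Literature.InformationTheory.Entropy.fiber
    exact_mod_cast h x
  simp_rw [hfib, hcard]
  rw [Finset.sum_const, nsmul_eq_mul, hcard]
  have hpos : (2 : ℝ) ^ n ≠ 0 := by positivity
  have hc' : (c : ℝ) ≠ 0 := by exact_mod_cast hc.ne'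
  have h2n : Real.logb 2 ((2 : ℝ) ^ n) = n := by
    rw [Real.logb_pow, Real.logb_self_eq_one one_lt_two, mul_one]
  rw [mul_div_cancel_left₀ _ hpos, Real.logb_div hpos hc', h2n]

/-- An injective map on `F₂ⁿ` has output entropy `n`. [DvirGutfreundRothblumVadhan2010, Claim 2.2] -/
theorem entropy_eq_of_constFibre_one {n : ℕ} (P : PolyMapF2 n) (h : ConstFibre P 1) :
    P.entropy = n := by
  rw [entropy_eq_of_constFibre P one_pos h]; simp

/-- An exactly two-to-one map on `F₂ⁿ` has output entropy `n - 1`.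
[DvirGutfreundRothblumVadhan2010, Claim 2.2] -/
theorem entropy_eq_of_constFibre_two {n : ℕ} (P : PolyMapF2 n) (h : ConstFibre P 2) :
    P.entropy = n - 1 := by
  rw [entropy_eq_of_constFibre P two_pos h, Nat.cast_ofNat, Real.logb_self_eq_one one_lt_two]

/-- YES-instances of INJ-vs-2TO1₃ are YES-instances of `PEA 3`. [card two-to-one-rigidity] -/
theorem injTwoToOne_yes_subset : ∀ ⦃w⦄, w ∈ InjTwoToOne.yes → w ∈ (PEA 3).yes := by
  intro w hw
  obtain ⟨I, hI, rfl⟩ : ∃ I, I ∈ _ ∧ PEAInst.encoding.encode I = w := hw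
  obtain ⟨hdeg, hk, hfib⟩ :
      PolyMapF2.DegLE 3 I.2.1 ∧ I.2.2 + 1 = I.1 ∧ ConstFibre I.2.1 1 := hI
  refine (encode_mem_PEA_yes_iff 3 I).2 ⟨hdeg, ?_⟩
  rw [entropy_eq_of_constFibre_one I.2.1 hfib]
  exact le_of_eq (by exact_mod_cast hk)

/-- NO-instances of INJ-vs-2TO1₃ are NO-instances of `PEA 3`. [card two-to-one-rigidity] -/
theorem injTwoToOne_no_subset : ∀ ⦃w⦄, w ∈ InjTwoToOne.no → w ∈ (PEA 3).no := by
  intro w hw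
  obtain ⟨I, hI, rfl⟩ : ∃ I, I ∈ _ ∧ PEAInst.encoding.encode I = w := hw
  obtain ⟨hdeg, hk, hfib⟩ :
      PolyMapF2.DegLE 3 I.2.1 ∧ I.2.2 + 1 = I.1 ∧ ConstFibre I.2.1 2 := hI
  refine (encode_mem_PEA_no_iff 3 I).2 ⟨hdeg, ?_⟩
  rw [entropy_eq_of_constFibre_two I.2.1 hfib]
  have : (I.1 : ℝ) = I.2.2 + 1 := by exact_mod_cast hk.symm
  linarith

/-- **Transfer of the line `Sketch` / card two-to-one-rigidity: hardness of the rigid sub-promise gives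
thesis X.**  If no polynomial-time algorithm tells injective cubic maps from exactly two-to-one cubic
maps, then `PEA 3 ∉ PromiseP`.  (The hypothesis is an open conjecture, stronger than X; not claimed.)
[card two-to-one-rigidity, First lemma] -/
theorem peaThreeNotInP_of_injTwoToOne (h : InjTwoToOne ∉ PromiseP) :
    Summit.PneNP.PneNP.Theses.SzkEntropy.PeaThreeNotInP := by
  rw [Summit.PneNP.PneNP.Theorems.szkEntropy_peaThreeNotInP_iff]
  intro hP
  obtain ⟨L, hL, hy, hn⟩ := hP
  exact h ⟨L, hL, fun w hw => hy (injTwoToOne_yes_subset hw), fun w hw => hn (injTwoToOne_no_subset hw)⟩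

/-- **stub_injTwoToOne** (registered name): `PEA 3 ∈ PromiseP → InjTwoToOne ∈ PromiseP` (a separator of
`PEA 3` separates its sub-promise). [card two-to-one-rigidity, First lemma] -/
theorem stub_injTwoToOne (hP : PEA 3 ∈ PromiseP) : InjTwoToOne ∈ PromiseP := by
  obtain ⟨L, hL, hy, hn⟩ := hP
  exact ⟨L, hL, fun w hw => hy (injTwoToOne_yes_subset hw), fun w hw => hn (injTwoToOne_no_subset hw)⟩

end Summit.PneNP.PneNP.Cruxes.PeaThreeNotInP.TwoToOneLine

end
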